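import Summits.BirchSwinnertonDyer.BirchSwinnertonDyer.Theorems.ByReductionTypeAtTwoMultUpperHalf
import Summits.BirchSwinnertonDyer.BirchSwinnertonDyer.Theses.ByReductionTypeAtTwo
import Summits.BirchSwinnertonDyer.Rank1Residual.X5.TwoAdicTargetsMultKatoInt
import Summits.BirchSwinnertonDyer.Rank1Residual.X5.TwoAdicTargetsEndStateClosed
import Literature.NumberTheory.EllipticCurves.BSDShaProofs
import Summits.BirchSwinnertonDyer.BirchSwinnertonDyer.Theorems.ByReductionTypeAtTwoMultUpperHalfKatoInt
import Summits.BirchSwinnertonDyer.BirchSwinnertonDyer.Theorems.ByReductionTypeAtTwoMultUpperHalfKatoIntDefs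
import Summits.BirchSwinnertonDyer.BirchSwinnertonDyer.Theorems.ByReductionTypeAtTwoMultUpperHalfDefs
import HarnessLib

/-!
# Route `ByReductionTypeAtTwo`, crux `MultUpperHalfAtTwo` (item stmt-BirchSwinnertonDyer-19922), fourth file:
# the PARITY road — Kato's divisibility at a non-split `2` with slack ONE power of `2` (the `c_∞ = 2`
# normalisation loss at positive discriminant) still gives the SHARP upper half, by Cassels–Tate

HONEST FRAMING (cell `bsd-2adic`, run/shared/lean/pub/bsd-2adic/, seat `bsd-2adic-mult-2` GEN 2, D-0074
row (A)): research route; nothing is booked; BSD is not proved by any of this. PARTITION: X5@2 mult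
(K4ᵐ, RESIDUAL-MAP B1·O1; 1 976 book230 classes) × p = 2 — types-the-object-of (a door for the UPPER half
on the 248 `E[2]`-irreducible, non-split, `2`-adically surjective classes of POSITIVE discriminant, where
the integral-Kato door T-KATO2-NSMULT is off by exactly one power of `2`: CENSUS-6 kit j248824,
«Δ > 0: v2pred = v₂ #Ш_an + 1, 248/248»); closes none.

The object. The cell's memo PROOF-KATO2MULT (Thm. A; kernel p419632 displays its `Δ < 0` case as
`O1.KatoDivisibilityAtTwoNonsplitMultInt`) proves Kato's divisibility `char_Λ X(E/ℚ_∞) ∣ L₂^{Ω⁺_E}` in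
`Λ = ℤ₂⟦T⟧` for `E` non-split multiplicative at `2` with `ρ_{E,2^∞}` surjective, the `2`-adic `L`-function
being normalised by the LEAST positive real period `Ω⁺_E`. The BSD period is `Ω_E = c_∞ · Ω⁺_E`
(`W.realPeriodRat = ∫_{E(ℝ)} |ω|`, `c_∞ = #π₀(E(ℝ)) = 2` iff `Δ_E > 0`), and the period ratio `ϖ = Ω⁺_f/Ω_E`
is a `2`-adic unit on the irreducible locus (Česnavičius 2018 Thm. 1.2, tree theorem
`padicValRat_periodRatio_eq_zero_of_irr_two`), so in the tree's G1 currency (`X5/TwoAdicTargetsB.lean`,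
`O1.KatoDivisibilityAtTwoMultUpTo W k f α L`: `2ⁿ·L = ι g`, `g ∈ char_Λ X`, `n ≤ k`) the memo gives slack
`k = ord₂ c_∞`: `k = 0` at `Δ < 0` (the door of p419632, SHARP) and `k = 1` at `Δ > 0`. The tree's consumer
`O1.upperBound_two_nonsplit_of_katoMult` turns slack `k` into `ord₂ #Ш ≤ ord₂ #Ш_an + k`. At `k = 1` the
lost power of `2` is recovered by PARITY: `#Ш(E/ℚ)` is a square (Cassels–Tate, PRINT named fact
`WeierstrassCurve.exists_casselsTate_pairing`, tree theorem `isSquare_shaOrder_of_casselsTate`; `Ш` is finite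
here by GZK), so `ord₂ #Ш` is even, and IF `ord₂ #Ш_an(E)` is even — a per-curve CERTIFICATE (exact
rational arithmetic on `L(E,1)/Ω_E`; `#Ш_an` is a square in every table, as BSD predicts, but its parity is
not a theorem) — then `ord₂ #Ш ≤ ord₂ #Ш_an + 1` forces `ord₂ #Ш ≤ ord₂ #Ш_an`.

* §1 `missingUpperBoundAt_two_nonsplit_of_katoMultUpTo_one_of_even` — per member: PRINT {A235 `h41ns`,
  modularity `hmod`, GZK `hGZK`, Cassels–Tate `hCT`, Česnavičius `hC`} + MEMO {`hK1` : G1 at slack `1` for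
  the curve's newform at every level and every non-split `2`-adic `L`-function — T-KATO2-NSMULT Thm. A
  read with `k = ord₂ c_∞ ≤ 1`} + the curve's decidable data {`Mult W 2`, non-split, `TwoAdicSurjective`}
  + analytic rank `0` + the CERTIFICATE `heven : ∃ q, #Ш_an(W) = q ∧ ord₂ q even` ⟹ `MissingUpperBoundAt W 2`.
  No `μ`, no `λ`, no `Δ`-sign, no reference curve.
* §2 `missingUpperBoundAt_two_mult_of_katoMultUpToOneMember` — class theorem: the same at ONE member
  `W₁ ~_ℚ W` + Cassels (`X12.missingUpperBoundAt_of_isIsogenous`, `hCassels`) ⟹ `MissingUpperBoundAt W 2`.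
  (Not folded into the `∀`-reduction of the crux: at the `∀`-level the parity input is itself an open
  statement — «`ord₂ #Ш_an` is even» — so the road is a per-class door, like every certificate door of
  the cell.)

References: [Kato2004Asterisque] 17.11–17.13 (shape; `p = 2 ∣ N` not in print); [GreenbergLNM1716] §4
pp. 112–113 (`l_v = 2` at a non-split `v`); [MazurTateTeitelbaum1986Invent] §I.10, §I.14;
[Cassels1962ArithmeticIV] / [SilvermanAEC2009] Thm. X.4.14 (alternating pairing, square order);
[Cesnavicius2018] Thm. 1.2; [Cassels1965ArithmeticVIII]; [Miller2011LMS] Def. 1.1.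
-/

set_option autoImplicit false
set_option linter.dupNamespace false

noncomputable section

open scoped Classical MatrixGroups ModularForm

open CongruenceSubgroup WeierstrassCurve Literature.NumberTheory.EllipticCurves
  Literature.NumberTheory.EllipticCurves.ModularForms
  Literature.NumberTheory.EllipticCurves.Greenberg1999
  Literature.NumberTheory.EllipticCurves.Rank1Residual
  Literature.NumberTheory.EllipticCurves.Rank1Residual.Typed
  Summit.BirchSwinnertonDyer.Rank1Residual.X5

namespace Summit.BirchSwinnertonDyer.BirchSwinnertonDyer.Theorems

/-! ## §0 Parity bookkeeping -/

/-- `ord₂` of a finite Tate–Shafarevich group is EVEN: `#Ш(E/ℚ)` is a square by the Cassels–Tate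
alternating pairing (named fact `exists_casselsTate_pairing`, tree theorem
`isSquare_shaOrder_of_casselsTate`), and `ord₂ (r·r) = 2·ord₂ r`.
[cite: SilvermanAEC2009, Thm. X.4.14] [cite: Cassels1962ArithmeticIV, Thm. 1.1 (alternating pairing; shape)] -/
theorem even_padicValNat_shaOrder_of_casselsTate
    (hCT : WeierstrassCurve.exists_casselsTate_pairing (K := ℚ)) (W : WeierstrassCurve ℚ) [W.IsElliptic]
    (hfin : Finite W.sha) (p : ℕ) [Fact p.Prime] : Even (padicValNat p W.shaOrder) := by
  have hfin' : W.ShaFinite := hfin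
  obtain ⟨r, hr⟩ := WeierstrassCurve.isSquare_shaOrder_of_casselsTate hCT W hfin'
  have hpos : 0 < W.shaOrder := W.shaOrder_pos hfin'
  have hr0 : r ≠ 0 := by
    rintro rfl
    rw [hr, mul_zero] at hpos
    exact lt_irrefl 0 hpos
  exact ⟨padicValNat p r, by rw [hr, padicValNat.mul hr0 hr0]⟩

/-- The parity squeeze: `a ≤ b + 1` with `a`, `b` even forces `a ≤ b`. [folklore] -/
private theorem le_of_le_add_one_of_even_of_even {a b : ℤ} (h : a ≤ b + 1) (ha : Even a) (hb : Even b) :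
    a ≤ b := by
  obtain ⟨u, hu⟩ := ha
  obtain ⟨v, hv⟩ := hb
  omega

/-! ## §1 Per member: slack-one Kato + square `Ш` + even `ord₂ #Ш_an` ⟹ the sharp upper half -/

/-- **`MissingUpperBoundAt W 2` at a NON-SPLIT `2` with `ρ_{E,2^∞}` surjective from Kato's divisibility with
ONE power of `2` of slack, by parity (PROVED modulo the displayed inputs).** Inputs: PRINT {A235 `h41ns`
(Greenberg's Thm-4.1 analogue at a non-split multiplicative prime: `l_v = 2` cancels MTT's `(1 − α⁻¹) = 2`),
modularity `hmod`, GZK `hGZK`, Cassels–Tate `hCT`, Česnavičius 2018 Thm. 1.2 `hC`}; MEMO {`hK1` — the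
tree's G1 `O1.KatoDivisibilityAtTwoMultUpTo W 1 f (-1) L` for every newform `f` of `W` (any level) and every
`L` (its guards `Mult`, non-split via `α = −1`, `TwoAdicSurjective` sit inside): `X` torsion and `2ⁿ·L ∈
ι(char_Λ X)` for some `n ≤ 1` — this is PROOF-KATO2MULT Thm. A (`char X ∣ L^{Ω⁺_E}`, `Ω⁺_E`-normalised)
rewritten with `Ω_E = c_∞·Ω⁺_E`, `ϖ ∈ ℤ₍₂₎ˣ`, `n = ord₂ c_∞ ≤ 1`; referee pending, NOT in print}; the
curve's data {analytic rank `0`, `Mult W 2`, non-split, `TwoAdicSurjective W`}; the CERTIFICATE `heven`: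
`#Ш_an(W) = q ∈ ℚ` with `ord₂ q` even. Chain: `O1.upperBound_two_nonsplit_of_katoMult` at `k = 1`, `m = 0`
(`ord₂ ϖ = 0`: surjective ⇒ irreducible ⇒ `padicValRat_periodRatio_eq_zero_of_irr_two`) gives
`ord₂ #Ш ≤ ord₂ q + 1`; `ord₂ #Ш` is even (§0); `ord₂ q` is even (`heven`, `q` is unique); hence
`ord₂ #Ш ≤ ord₂ q`. No `μ`, no `λ`, no sign of `Δ`, no reference curve — the door for the 248
positive-discriminant classes where T-KATO2-NSMULT alone is off by one.
[cite: GreenbergLNM1716, §4 pp. 112–113] [cite: MazurTateTeitelbaum1986Invent, §I.10 and §I.14]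
[cite: SilvermanAEC2009, Thm. X.4.14] [cite: Cesnavicius2018, Thm. 1.2] [cite: Miller2011LMS, Def. 1.1] -/
theorem missingUpperBoundAt_two_nonsplit_of_katoMultUpTo_one_of_even
    (h41ns : thm41Analogue_charValue_rankZero_numberField_anyPrime)
    (hmod : nonempty_modularParametrizationData)
    (hGZK : rank_eq_analyticRank_of_analyticRank_le_one)
    (hCT : WeierstrassCurve.exists_casselsTate_pairing (K := ℚ))
    (hC : cesnavicius_not_two_dvd_maninConstant_of_two_dvd_level)
    (W : WeierstrassCurve ℚ) [W.IsElliptic] [W.IsGloballyMinimal]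
    (hK1 : ∀ {N : ℕ} [NeZero N] (f : CuspForm (Gamma0 N) 2) (L : PowerSeries ℚ_[2]),
      O1.KatoDivisibilityAtTwoMultUpTo W 1 f (-1) L)
    (hr : W.analyticRank = 0) (hmult : Mult W 2) (hns : ¬ W.HasSplitMultiplicativeReductionAtPrime 2)
    (him : O1.TwoAdicSurjective W)
    (heven : ∃ q : ℚ, shaAn W = (q : ℂ) ∧ Even (padicValRat 2 q)) : MissingUpperBoundAt W 2 := by
  haveI : NeZero (W.conductorNorm ℤ) := ⟨(W.conductorNorm_pos_holds).ne'⟩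
  obtain ⟨Dm⟩ := hmod W
  have hf : IsNewformOf W Dm.f := Dm.isNewformOf
  have hL : W.entireLFunction 1 ≠ 0 :=
    (W.analyticRank_eq_zero_iff_holds hf.hasEntireLFunction).mp hr
  obtain ⟨ϖ, -, hϖeq, -⟩ := Dm.exists_rat_mul_realPeriodRat_eq_plusPeriod
  obtain ⟨κ, hκ, γ, hγ, hγ'⟩ := exists_isCyclotomic_isTopGenerator_isCyclotomicVariable_holds 2
  obtain ⟨D⟩ := W.nonempty_selmerDualData_holds κ γ hγ
  obtain ⟨L, hLf⟩ := exists_isMultPAdicLFunctionOf_neg_one_of_nonsplit hf hmult hns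
  -- the period ratio is a `2`-adic unit on the irreducible locus
  have hirr : Irr W 2 := O1.irr_two_of_twoAdicSurjective W him
  have hper : padicValRat 2 ϖ = 0 :=
    padicValRat_periodRatio_eq_zero_of_irr_two hC W hmult hirr Dm.f hf ϖ hϖeq
  -- Kato with slack one: `ord₂ #Ш ≤ ord₂ q + 1`
  obtain ⟨q, hq, hle⟩ := O1.upperBound_two_nonsplit_of_katoMult W
    (O1.twoAdicEulerCharRankZeroNonsplitMult_zero_of_greenberg W h41ns) hGZK hmult hns hL hκ hγ hγ' hf
    hLf (hK1 Dm.f L) him D ϖ hϖeq 0 (by rw [hper]; norm_num)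
  have hle' : (padicValNat 2 W.shaOrder : ℤ) ≤ padicValRat 2 q + 1 := by simpa using hle
  -- `ord₂ #Ш` is even (Cassels–Tate), `ord₂ q` is even (certificate; `q` is unique)
  have hfin : Finite W.sha := (hGZK W (by rw [hr]; exact zero_le_one)).2
  have hevenSha : Even ((padicValNat 2 W.shaOrder : ℕ) : ℤ) :=
    (even_padicValNat_shaOrder_of_casselsTate hCT W hfin 2).natCast
  obtain ⟨q', hq', hevq'⟩ := heven
  have hqq : q' = q := by exact_mod_cast hq'.symm.trans hq
  subst hqq
  exact ⟨q', hq, le_of_le_add_one_of_even_of_even hle' hevenSha hevq'⟩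

/-! ## §2 The class theorem through the parity road -/

/-- **The upper half at a multiplicative `2` from ONE parity-road member of the isogeny class.** For a
globally minimal elliptic `W/ℚ` of analytic rank `0` multiplicative at `2` and a globally minimal
`W₁ ~_ℚ W` that is NON-SPLIT at `2` and `2`-adically surjective, with G1 at slack `1` at `W₁` (`hK1`, MEMO
T-KATO2-NSMULT Thm. A with `k = ord₂ c_∞`) and the certificate «`ord₂ #Ш_an(W₁)` even» (`heven`):
`MissingUpperBoundAt W 2` (§1 at `W₁`; class data by `X2.IsogenyQuotientLine.hasMultiplicativeReductionAtPrime_of_isIsogenous`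
and `analyticRank_eq_of_isIsogenous'`; Cassels `X12.missingUpperBoundAt_of_isIsogenous`). Binders: PRINT
{`h41ns`, `hmod`, `hGZK`, `hCassels`, `hCT`, `hC`} + MEMO {`hK1` at `W₁`} + CERTIFICATE {`heven` at `W₁`}.
[cite: GreenbergLNM1716, §4 pp. 112–113] [cite: SilvermanAEC2009, Thm. X.4.14] [cite: Cesnavicius2018, Thm. 1.2]
[cite: Cassels1965ArithmeticVIII] [cite: Miller2011LMS, §1 and Def. 1.1] -/
theorem missingUpperBoundAt_two_mult_of_katoMultUpToOneMember
    (h41ns : thm41Analogue_charValue_rankZero_numberField_anyPrime)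
    (hmod : nonempty_modularParametrizationData)
    (hGZK : rank_eq_analyticRank_of_analyticRank_le_one)
    (hCassels : bsdRHS_eq_of_isIsogenous)
    (hCT : WeierstrassCurve.exists_casselsTate_pairing (K := ℚ))
    (hC : cesnavicius_not_two_dvd_maninConstant_of_two_dvd_level)
    (W : WeierstrassCurve ℚ) [W.IsElliptic] [W.IsGloballyMinimal]
    (hr : W.analyticRank = 0) (hmult : Mult W 2)
    (W₁ : WeierstrassCurve ℚ) [W₁.IsElliptic] [W₁.IsGloballyMinimal] (hiso : IsIsogenous W W₁)
    (hns₁ : ¬ W₁.HasSplitMultiplicativeReductionAtPrime 2) (him₁ : O1.TwoAdicSurjective W₁)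
    (hK1 : ∀ {N : ℕ} [NeZero N] (f : CuspForm (Gamma0 N) 2) (L : PowerSeries ℚ_[2]),
      O1.KatoDivisibilityAtTwoMultUpTo W₁ 1 f (-1) L)
    (heven₁ : ∃ q : ℚ, shaAn W₁ = (q : ℂ) ∧ Even (padicValRat 2 q)) :
    MissingUpperBoundAt W 2 := by
  have hmult₁ : Mult W₁ 2 :=
    Summit.BirchSwinnertonDyer.Rank1Residual.X2.IsogenyQuotientLine.hasMultiplicativeReductionAtPrime_of_isIsogenous
      hiso hmult
  have hr₁ : W₁.analyticRank = 0 := (analyticRank_eq_of_isIsogenous' hiso).symm.trans hr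
  have hU₁ : MissingUpperBoundAt W₁ 2 :=
    missingUpperBoundAt_two_nonsplit_of_katoMultUpTo_one_of_even h41ns hmod hGZK hCT hC W₁ hK1 hr₁
      hmult₁ hns₁ him₁ heven₁
  haveI : NeZero (W₁.conductorNorm ℤ) := ⟨(W₁.conductorNorm_pos_holds).ne'⟩
  obtain ⟨Dm⟩ := hmod W₁
  have hlead₁ : W₁.leadingLCoeff ≠ 0 :=
    W₁.leadingLCoeff_ne_zero_holds Dm.isNewformOf.hasEntireLFunction
  have hfin₁ : Finite W₁.sha := (hGZK W₁ (by rw [hr₁]; exact zero_le_one)).2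
  exact Summit.BirchSwinnertonDyer.Rank1Residual.X12.missingUpperBoundAt_of_isIsogenous hCassels hiso
    hfin₁ hlead₁ hU₁

/-! ## §3 (appended, same seat) The crux decl: four roads at the optimal curve + the typed residual

The `∀`-form of §1–§2: the parity road joins the three roads of `ByReductionTypeAtTwoMultUpperHalfKatoInt.lean`
(p424960); the per-curve datum «`ord₂ #Ш_an(W₀)` even» sits INSIDE the residual hypothesis (decidable per curve),
so no new conjecture leaf is needed for it; the MEMO leaf is the slack-one door `KatoUpToOneAtNonsplitSurjectiveTwo`
and the residual leaf is `UpperHalfOffFourRoadsAtMultTwo` (both in `…MultUpperHalfKatoIntDefs.lean`). -/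

/-- **Item stmt-BirchSwinnertonDyer-19922 `MultUpperHalfAtTwo` as «four roads + residual» (conditional;
FULLY-QUALIFIED type).** PRINT {A235 `h41ns`, A236 `h41sp`, modularity `hmod`, GZK `hGZK`, Cassels `hCassels`,
Greenberg Prop. 5.14 at `2` `h514`, Česnavičius Thm. 1.2 `hC`, Cassels–Tate `hCT`} + MEMO {Kato `⊗ℚ` at a
multiplicative `2` `hKato` (RC-2), Greenberg–Stevens at a split `2` `hGS` (RC-4), T-KATO2-NSMULT sharp door
`hKint` (p419632 display, `Δ < 0`) and at slack one `hK1` (the tree's G1 at `k = 1`, both signs of `Δ`; memo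
PROOF-KATO2MULT Thm. A + §4.7 Cor. C, referee pending)} + ONE residual hypothesis `hoff` — the upper half AT THE
`X₀(N)`-OPTIMAL CURVES `W₀` (globally minimal, non-CM, analytic rank `0`, multiplicative at `2`, lattice-optimal
datum at level `N_{W₀}`) that are off all four roads: (i) cyclotomic `μ` not known to vanish, (ii) no Prop-5.14
datum, (iii) NOT (non-split ∧ `TwoAdicSurjective` ∧ `Δ < 0`), (iv) NOT (non-split ∧ `TwoAdicSurjective` ∧
`#Ш_an(W₀) = q` with `ord₂ q` even) — imply `MultUpperHalfAtTwo`. Proof: optimal member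
(`X12.exists_isIsogenous_optimal`); roads (i)/(ii) p418902, (iii) p424960, (iv) p427239 (Cassels inside each);
else `hoff` + Cassels. A partition certificate, not a proof of the item: the residual is expected NON-EMPTY.
[cite: Kato2004Asterisque, Thm. 17.4 (p. 273) and 17.11–17.13 (pp. 277–280)]
[cite: GreenbergLNM1716, Prop. 5.13, Prop. 5.14 (pp. 120–122), §4 pp. 112–113 and p. 124 (195A1)]
[cite: SilvermanAEC2009, Thm. X.4.14] [cite: Cesnavicius2018, Thm. 1.2] [cite: Cassels1965ArithmeticVIII]
[cite: Miller2011LMS, Def. 1.1] -/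
theorem multUpperHalfAtTwo_of_fourRoads
    (hKato : ∀ (W : WeierstrassCurve ℚ) [W.IsElliptic] [W.IsGloballyMinimal],
      ¬ W.HasCM → Mult W 2 → O1.KatoMultiplicativeDivisibilityRat W 2)
    (h41ns : thm41Analogue_charValue_rankZero_numberField_anyPrime)
    (h41sp : thm41Analogue_charValue_rankZero_split_baseChange_anyPrime)
    (hmod : nonempty_modularParametrizationData)
    (hGZK : rank_eq_analyticRank_of_analyticRank_le_one)
    (hCassels : bsdRHS_eq_of_isIsogenous)
    (h514 : prop514_isTorsion_mu_eq_zero_two)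
    (hC : cesnavicius_not_two_dvd_maninConstant_of_two_dvd_level)
    (hCT : WeierstrassCurve.exists_casselsTate_pairing (K := ℚ))
    (hGS : ∀ (W : WeierstrassCurve ℚ) [W.IsElliptic] [W.IsGloballyMinimal],
      W.HasSplitMultiplicativeReductionAtPrime 2 → greenberg_stevens (W := W) (p := 2))
    (hKint : ∀ (W : WeierstrassCurve ℚ) [W.IsElliptic] [W.IsGloballyMinimal],
      O1.KatoDivisibilityAtTwoNonsplitMultInt W)
    (hK1 : ∀ (W : WeierstrassCurve ℚ) [W.IsElliptic] [W.IsGloballyMinimal] {N : ℕ} [NeZero N]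
      (f : CuspForm (Gamma0 N) 2) (L : PowerSeries ℚ_[2]), O1.KatoDivisibilityAtTwoMultUpTo W 1 f (-1) L)
    (hoff : ∀ (W₀ : WeierstrassCurve ℚ) [W₀.IsElliptic] [W₀.IsGloballyMinimal]
      [NeZero (W₀.conductorNorm ℤ)], ¬ W₀.HasCM → W₀.analyticRank = 0 → Mult W₀ 2 →
      ∀ D₀ : ModularParametrizationData W₀ (W₀.conductorNorm ℤ), Zhai2021.IsOptimalDatum W₀ D₀ →
      (¬ ∀ (κ : ZpExtension ℚ 2) (γ : Field.absoluteGaloisGroup ℚ), κ.IsCyclotomic →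
          κ.IsTopGenerator γ → IsCyclotomicVariable 2 γ → ∀ D : W₀.SelmerDualData κ γ, D.mu = 0) →
      (¬ ∃ x y : ℚ, W₀.toAffine.Equation x y ∧ 2 * y + W₀.a₁ * x + W₀.a₃ = 0 ∧
          ((TwoTorsionRamifiedAtTwo x ∧ ¬ TwoTorsionOdd W₀ x) ∨
            (TwoTorsionOdd W₀ x ∧ ¬ TwoTorsionRamifiedAtTwo x))) →
      ¬ (¬ W₀.HasSplitMultiplicativeReductionAtPrime 2 ∧ O1.TwoAdicSurjective W₀ ∧ W₀.Δ < 0) →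
      ¬ (¬ W₀.HasSplitMultiplicativeReductionAtPrime 2 ∧ O1.TwoAdicSurjective W₀ ∧
          ∃ q : ℚ, shaAn W₀ = (q : ℂ) ∧ Even (padicValRat 2 q)) →
      MissingUpperBoundAt W₀ 2) :
    Summit.BirchSwinnertonDyer.BirchSwinnertonDyer.Theses.ByReductionTypeAtTwo.MultUpperHalfAtTwo := by
  unfold Summit.BirchSwinnertonDyer.BirchSwinnertonDyer.Theses.ByReductionTypeAtTwo.MultUpperHalfAtTwo
  intro W _ _ _ hr hmult
  have hnf : exists_isNewformOf := exists_isNewformOf_of_nonempty_modularParametrizationData hmod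
  -- the optimal member of the class
  obtain ⟨W₀, hE₀, hM₀, hN₀, D₀, hiso, -, hopt⟩ :=
    Summit.BirchSwinnertonDyer.Rank1Residual.X12.exists_isIsogenous_optimal hnf W
  -- road (i): `μ = 0` at `W₀`
  by_cases hμ₀ : ∀ (κ : ZpExtension ℚ 2) (γ : Field.absoluteGaloisGroup ℚ), κ.IsCyclotomic →
      κ.IsTopGenerator γ → IsCyclotomicVariable 2 γ → ∀ D : W₀.SelmerDualData κ γ, D.mu = 0
  · exact missingUpperBoundAt_two_mult_of_roadMember hKato h41ns h41sp hmod hGZK hCassels h514 hC hGS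
      W hr hmult W₀ hiso (Or.inl hμ₀) (Or.inr (Or.inl fun {_} ↦ ⟨D₀, hopt⟩))
  -- road (ii): a Prop-5.14 datum at `W₀`
  by_cases h514₀ : ∃ x y : ℚ, W₀.toAffine.Equation x y ∧ 2 * y + W₀.a₁ * x + W₀.a₃ = 0 ∧
      ((TwoTorsionRamifiedAtTwo x ∧ ¬ TwoTorsionOdd W₀ x) ∨
        (TwoTorsionOdd W₀ x ∧ ¬ TwoTorsionRamifiedAtTwo x))
  · exact missingUpperBoundAt_two_mult_of_roadMember hKato h41ns h41sp hmod hGZK hCassels h514 hC hGS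
      W hr hmult W₀ hiso (Or.inr h514₀) (Or.inr (Or.inl fun {_} ↦ ⟨D₀, hopt⟩))
  -- road (iii): the sharp integral-Kato door at `W₀` (`Δ < 0`)
  by_cases hdoor : ¬ W₀.HasSplitMultiplicativeReductionAtPrime 2 ∧ O1.TwoAdicSurjective W₀ ∧ W₀.Δ < 0
  · exact missingUpperBoundAt_two_mult_of_katoIntMember h41ns hmod hGZK hCassels hC W hr hmult W₀ hiso
      hdoor.1 hdoor.2.1 hdoor.2.2 (hKint W₀)
  -- road (iv): the slack-one door + parity at `W₀`
  by_cases hpar : ¬ W₀.HasSplitMultiplicativeReductionAtPrime 2 ∧ O1.TwoAdicSurjective W₀ ∧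
      ∃ q : ℚ, shaAn W₀ = (q : ℂ) ∧ Even (padicValRat 2 q)
  · exact missingUpperBoundAt_two_mult_of_katoMultUpToOneMember h41ns hmod hGZK hCassels hCT hC W hr hmult
      W₀ hiso hpar.1 hpar.2.1 (fun f L ↦ hK1 W₀ f L) hpar.2.2
  -- off the roads: the residual hypothesis at `W₀`, then Cassels
  have hmult₀ : Mult W₀ 2 :=
    Summit.BirchSwinnertonDyer.Rank1Residual.X2.IsogenyQuotientLine.hasMultiplicativeReductionAtPrime_of_isIsogenous
      hiso hmult
  have hr₀ : W₀.analyticRank = 0 := (analyticRank_eq_of_isIsogenous' hiso).symm.trans hr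
  have hcm₀ : ¬ W₀.HasCM := fun h ↦ Rank1Residual.not_mult_of_hasCM W₀ h 2 hmult₀
  have hU₀ : MissingUpperBoundAt W₀ 2 := hoff W₀ hcm₀ hr₀ hmult₀ D₀ hopt hμ₀ h514₀ hdoor hpar
  obtain ⟨Dm⟩ := hmod W₀
  have hlead₀ : W₀.leadingLCoeff ≠ 0 :=
    W₀.leadingLCoeff_ne_zero_holds Dm.isNewformOf.hasEntireLFunction
  have hfin₀ : Finite W₀.sha := (hGZK W₀ (by rw [hr₀]; exact zero_le_one)).2
  exact Summit.BirchSwinnertonDyer.Rank1Residual.X12.missingUpperBoundAt_of_isIsogenous hCassels hiso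
    hfin₀ hlead₀ hU₀

/-! ## §4 (appended) GLUE from the closed leaves -/

/-- **GLUE (four roads): item stmt-BirchSwinnertonDyer-19922 `MultUpperHalfAtTwo` from its layer-3 leaves.**
PRINT ×8 → MEMO leaves {`MultUpperHalvesAtTwo.GreenbergStevensAtSplitTwo`, `…KatoRatAtMultTwo` (p420550),
`…KatoIntAtNonsplitSurjectiveTwo` (p425255), `…KatoUpToOneAtNonsplitSurjectiveTwo`} → RESIDUAL leaf
`…UpperHalfOffFourRoadsAtMultTwo` → `MultUpperHalfAtTwo`; one application of `multUpperHalfAtTwo_of_fourRoads`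
(the leaves unfold to its binders by `rfl`). [cite: Kato2004Asterisque, Thm. 17.4 (p. 273) (shape)]
[cite: GreenbergLNM1716, Prop. 5.14 (p. 121) and §4 pp. 112–113] [cite: Miller2011LMS, Def. 1.1] -/
theorem multUpperHalfAtTwo_of_leaves_fourRoads
    (h41ns : thm41Analogue_charValue_rankZero_numberField_anyPrime)
    (h41sp : thm41Analogue_charValue_rankZero_split_baseChange_anyPrime)
    (hmod : nonempty_modularParametrizationData)
    (hGZK : rank_eq_analyticRank_of_analyticRank_le_one)
    (hCassels : bsdRHS_eq_of_isIsogenous)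
    (h514 : prop514_isTorsion_mu_eq_zero_two)
    (hC : cesnavicius_not_two_dvd_maninConstant_of_two_dvd_level)
    (hCT : WeierstrassCurve.exists_casselsTate_pairing (K := ℚ))
    (hGS : MultUpperHalvesAtTwo.GreenbergStevensAtSplitTwo)
    (hKato : MultUpperHalvesAtTwo.KatoRatAtMultTwo)
    (hKint : MultUpperHalvesAtTwo.KatoIntAtNonsplitSurjectiveTwo)
    (hK1 : MultUpperHalvesAtTwo.KatoUpToOneAtNonsplitSurjectiveTwo)
    (hoff : MultUpperHalvesAtTwo.UpperHalfOffFourRoadsAtMultTwo) :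
    Summit.BirchSwinnertonDyer.BirchSwinnertonDyer.Theses.ByReductionTypeAtTwo.MultUpperHalfAtTwo :=
  multUpperHalfAtTwo_of_fourRoads hKato h41ns h41sp hmod hGZK hCassels h514 hC hCT hGS hKint hK1 hoff

/-- **GLUE (three roads): the reduction of p424960 from its leaves.** PRINT ×7 → MEMO leaves
{`…GreenbergStevensAtSplitTwo`, `…KatoRatAtMultTwo`, `…KatoIntAtNonsplitSurjectiveTwo`} → RESIDUAL leaf
`…UpperHalfOffRoadsAtMultTwo` (p425255) → `MultUpperHalfAtTwo`; one application of
`multUpperHalfAtTwo_of_katoInt_of_optimalMuZero_of_offRoads`. [cite: Kato2004Asterisque, Thm. 17.4 (p. 273) (shape)]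
[cite: GreenbergLNM1716, Prop. 5.14 (p. 121) and §4 pp. 112–113] [cite: Miller2011LMS, Def. 1.1] -/
theorem multUpperHalfAtTwo_of_leaves_katoInt
    (h41ns : thm41Analogue_charValue_rankZero_numberField_anyPrime)
    (h41sp : thm41Analogue_charValue_rankZero_split_baseChange_anyPrime)
    (hmod : nonempty_modularParametrizationData)
    (hGZK : rank_eq_analyticRank_of_analyticRank_le_one)
    (hCassels : bsdRHS_eq_of_isIsogenous)
    (h514 : prop514_isTorsion_mu_eq_zero_two)
    (hC : cesnavicius_not_two_dvd_maninConstant_of_two_dvd_level)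
    (hGS : MultUpperHalvesAtTwo.GreenbergStevensAtSplitTwo)
    (hKato : MultUpperHalvesAtTwo.KatoRatAtMultTwo)
    (hKint : MultUpperHalvesAtTwo.KatoIntAtNonsplitSurjectiveTwo)
    (hoff : MultUpperHalvesAtTwo.UpperHalfOffRoadsAtMultTwo) :
    Summit.BirchSwinnertonDyer.BirchSwinnertonDyer.Theses.ByReductionTypeAtTwo.MultUpperHalfAtTwo :=
  multUpperHalfAtTwo_of_katoInt_of_optimalMuZero_of_offRoads hKato h41ns h41sp hmod hGZK hCassels h514 hC
    hGS hKint hoff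

end Summit.BirchSwinnertonDyer.BirchSwinnertonDyer.Theorems

end
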